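import Literature.Barriers.RiemannHypothesis.EpsteinZetaVoroninReduction
import HarnessLib

/-!
# Voronin's theorem on the zeros of Epstein zeta functions in `½ < σ < 1`: decomposition of the
# named fact `Voronin1976_epsteinStrip` (fact-decompose, 2026-08-16)

The named fact `Literature.Barriers.RiemannHypothesis.Voronin1976_epsteinStrip`
(`EpsteinZetaRealZeros.lean`; Titchmarsh §10.27: for an integral positive definite binary form
`Q` of fundamental discriminant `d` with `h(d) > 1`, `ζ_Q` has `≫ T` zeros in
`½ < σ₁ ≤ σ ≤ σ₂ < 1`, `0 < t ≤ T`; Voronin 1976) has the printed two-part proof (Voronin 1976;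
Karatsuba–Voronin, *The Riemann Zeta-Function*, Ch. VII §3; Bauer 2003 as reported by Steuding,
*Value-Distribution of L-Functions*, §13.8, p. 235):

* (U) the **joint universality theorem, with positive lower density, for the `L`-functions of
  the class group characters of an imaginary quadratic field** (pairwise non-equivalent
  characters `χᵢ ≠ χⱼ, χ̄ⱼ`), and
* (R) the **reduction** `ζ_Q = (w/h) Σ_χ χ̄(A) L(s, χ)`, zero-free targets whose combination
  vanishes at the centre of a disc, Rouché, counting the shifts.

(R) is PROVED in the tree: `Voronin1976_epsteinStrip_of_jointUniversality`
(`EpsteinZetaVoroninReduction.lean`) takes (U), written out, as its only hypothesis. This file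
records the decomposition of the fact along that cut:

* `Voronin1976_classGroupJointUniversality` — **(U) as a named fact** (child; the exact
  hypothesis of the reduction theorem): Voronin's lemma, a special case of Bauer's joint
  universality theorem for Artin `L`-functions (Steuding 2007, Thm. 13.6: the `L(s, χ)` are the
  Artin `L`-functions of the dihedral representations `Ind_K^ℚ χ` of `Gal(H_K/ℚ)`, irreducible and
  pairwise inequivalent exactly when the `χᵢ` are pairwise non-equivalent). Towards its proof the
  tree already holds the joint denseness lemma (`ClassGroupJointDenseness.lean`, proved), the
  finite Euler products and their mean square (`ClassGroupUniversalityTorus.lean`,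
  `ClassGroupEulerProductMeanSquare.lean`) and the complete Dirichlet-character analogue
  (`Pankowski2010_thm1_1_discAnalytic_holds`, `HybridJointUniversalityProofs.lean`).
* `Voronin1976_epsteinStrip_holds_of` — **the assembly** `(U) → Voronin1976_epsteinStrip`
  (proved: the reduction theorem).

No other declaration; nothing else is asserted.

## References

* [Voronin1976QuadraticForms] S. M. Voronin, *On the zeros of zeta-functions of quadratic
  forms*, Trudy Mat. Inst. Steklov. 142 (1976), 135–147 (main lemma: joint universality of the
  class group `L`-functions; cited through Titchmarsh §10.27 and Steuding p. 235).
* [KaratsubaVoronin1992] A. A. Karatsuba, S. M. Voronin, *The Riemann Zeta-Function*, de Gruyter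
  1992, Ch. VII, §3 (zeros of zeta-functions of quadratic forms: the joint universality theorem
  for the `L`-functions of the ideal classes and the deduction).
* [Steuding2007] J. Steuding, *Value-Distribution of L-Functions*, LNM 1877 (2007), §13.8,
  Thm. 13.6 (Bauer), p. 235.
* [Titchmarsh1986] E. C. Titchmarsh, *The Theory of the Riemann Zeta-Function*, 2nd ed.,
  §10.27.
-/

noncomputable section

open Complex Filter Set Metric MeasureTheory
open scoped NumberField
open Literature.NumberTheory.LFunctions.NumberField

namespace Literature.Barriers.RiemannHypothesis

/-- **Voronin 1976, joint universality of the class group `L`-functions of an imaginary quadratic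
field, with positive lower density** (named fact; the lemma of Voronin's paper on the zeros of
zeta-functions of quadratic forms, Karatsuba–Voronin Ch. VII §3; a special case of Bauer's joint
universality of Artin `L`-functions, Steuding 2007 Thm. 13.6). Statement (the hypothesis of
`Voronin1976_epsteinStrip_of_jointUniversality`, verbatim): for every imaginary quadratic field
`K` (`[K : ℚ] = 2`, `d_K < 0`), every finite non-empty family `χ : ι → (Cl_K →* ℂˣ)` of class
group characters with `χ i ≠ χ j` and `χ i ≠ (χ j)⁻¹` for `i ≠ j` (pairwise non-equivalent:
`L(s, χ⁻¹) = L(s, χ)`), every closed disc `|s − c| ≤ ρ`, `0 < ρ < R`, inside the strip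
(`½ < Re c − ρ`, `Re c + ρ < 1`), all targets `f i` holomorphic on `|s − c| < R` and zero-free on
the closed disc, and every `ε > 0`, there are `δ > 0` and `T₀` such that for `T ≥ T₀` the set of
shifts `τ ∈ [0, T]` with `‖L(s + iτ, χ i) − f i (s)‖ < ε` for all `i` and all `|s − c| ≤ ρ` has
Lebesgue measure at least `δ T` (`L(s, χ) = classGroupLFunction K χ s`, the analytic continuation
of `Σ_𝔞 χ([𝔞]) N𝔞⁻ˢ`, `UniformClassGroupPNT.lean`). "Positive lower density" is rendered as
`∃ δ > 0, eventually meas ≥ δ T`, equivalent to `liminf (1/T) meas > 0`.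
[cite: Voronin1976QuadraticForms, main lemma (joint universality of the class group L-functions), via Titchmarsh1986 §10.27 and Steuding2007 p. 235]
[cite: KaratsubaVoronin1992, Ch. VII §3]
[cite: Steuding2007, Thm. 13.6 and §13.8 (p. 235)] -/
def Voronin1976_classGroupJointUniversality : Prop :=
  ∀ (K : Type) [Field K] [NumberField K], Module.finrank ℚ K = 2 →
    NumberField.discr K < 0 →
    ∀ (ι : Type) [Fintype ι] [Nonempty ι] (χ : ι → (ClassGroup (𝓞 K) →* ℂˣ)),
      (Pairwise fun i j ↦ χ i ≠ χ j ∧ χ i ≠ (χ j)⁻¹) →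
      ∀ (c : ℂ) (ρ R : ℝ), 0 < ρ → ρ < R → 1 / 2 < c.re - ρ → c.re + ρ < 1 →
      ∀ f : ι → ℂ → ℂ, (∀ i, DifferentiableOn ℂ (f i) (ball c R)) →
        (∀ i, ∀ s ∈ closedBall c ρ, f i s ≠ 0) →
      ∀ ε : ℝ, 0 < ε →
        ∃ δ : ℝ, 0 < δ ∧ ∃ T₀ : ℝ, ∀ T : ℝ, T₀ ≤ T →
          ENNReal.ofReal (δ * T) ≤
            volume ({τ : ℝ | ∀ i, ∀ s ∈ closedBall c ρ,
              ‖classGroupLFunction K (χ i) (s + τ * I) - f i s‖ < ε} ∩ Icc 0 T)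

/-- **Assembly: `Voronin1976_epsteinStrip` from Voronin's joint universality lemma** — the
printed deduction (class group character expansion of `ζ_Q`, zero-free targets, Rouché, counting
of the shifts of positive lower density), which is the tree's theorem
`Voronin1976_epsteinStrip_of_jointUniversality`. With this the named fact is split into the single
child `Voronin1976_classGroupJointUniversality`; its discharge `Voronin1976_epsteinStrip_holds` is
this theorem applied to `Voronin1976_classGroupJointUniversality_holds` once that lands.
[cite: Titchmarsh1986, §10.27] [cite: KaratsubaVoronin1992, Ch. VII §3]
[cite: Voronin1976QuadraticForms, main theorem, via Titchmarsh1986 §10.27] -/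
theorem Voronin1976_epsteinStrip_holds_of (hU : Voronin1976_classGroupJointUniversality) :
    Voronin1976_epsteinStrip :=
  Voronin1976_epsteinStrip_of_jointUniversality hU

end Literature.Barriers.RiemannHypothesis

end
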